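import Summits.ValiantsHypothesis.ValiantsHypothesis.Theorems.LacunarySymmetroidMatrixDescartesSeparatedSectorRelative

/-!
# `MatrixDescartes` — the LETTER-SEPARATED SECTOR from an ENDPOINT CERTIFICATE: finitely many monomial
# inequalities at the window ends give `Z₊ ≤ N·m`

HONEST FRAMING.  Object-search cell `pub-symmetroid`, crux `Theses.LacunarySymmetroid.MatrixDescartes`
(ledger item `stmt-ValiantsHypothesis-18050`, route `LacunarySymmetroid`; seat `val-sym-mdr-p2`, gen 12).  The
crux implies `VP ≠ VNP` by the route's assembly; NOTHING here is progress on it and nothing here is a claim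
about `VP ≠ VNP`, `DoorA26` / `DoorA34` or the cell's registers.

The relative sector theorem (`card_posRoots_le_of_relSeparated`, file `…SeparatedSectorRelative.lean`) asks for
smallness of the other letters on whole intervals and for a dominance cover of the rest of the axis.  Ratios of
monomials `σ_l x^(d l) / σ_a x^(d a)` are MONOTONE in `x` (`small_of_small_at_left`, `small_of_small_at_right`),
so for windows chained along the exponent order everything follows from FINITELY MANY inequalities at the `2N`
window endpoints (`card_posRoots_le_of_endpointCert`):

* windows `(u j, v j)`, `0 < u j < v j ≤ u (j+1)`, live pairs `(a j, b j)` with `d (a j) < d (b j)`,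
  `a (j+1) = b j`, `a 0` the lowest and `b (N−1)` the highest letter;
* HAND-OVER at the ends: `σ_b u^(d b) ≤ ε·σ_a u^(d a)` and `σ_a v^(d a) ≤ ε·σ_b v^(d b)`;
* every OTHER letter `l` is `κ j l`-small at one end: `d l < d a ∧ σ_l u^(d l) ≤ κ·σ_a u^(d a)` or
  `d b < d l ∧ σ_l v^(d l) ≤ κ·σ_b v^(d b)`, with weights `∑_l κ j l ≤ Λ` per window (geometric decay of far
  letters is free);
* constants: `|det S l| ≥ η·σ_l^m`, `ε' = 2ε + 2Λ ≤ 1`, `(m+1)^m·m!·m·3^m·ε' < η` — uniform in `K`.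

Then `Z₊ ≤ N·m`.  The cover of the positive axis by the windows, the gaps `[v j, u (j+1)]` (live letter `b j`),
the initial segment `(0, u 0]` (live `a 0`) and the final ray (live `b (N−1)`) is `cover_of_chain`; in each gap
the two neighbouring letters are `ε`-small and the far ones sum to `≤ 2Λ`, whence `ε'`.  This is the form in which an
explicit family (a design with prescribed scales) is certified by pure arithmetic.  Sector bookkeeping beside
the crux. [folklore]
-/

-- `Summit.ValiantsHypothesis.ValiantsHypothesis.…` repeats a component by the D-0017 layout
-- (single-conjunct summit), which the `dupNamespace` linter flags; the name is mandated.
set_option linter.dupNamespace false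

namespace Summit.ValiantsHypothesis.ValiantsHypothesis.Theorems.LacunarySymmetroidMatrixDescartes.Separated

open Polynomial Complex Set Finset
open scoped BigOperators Matrix Real

/-! ## §11 Endpoint certificates: finitely many monomial inequalities at the window ends suffice -/

section Endpoint

variable {K m : ℕ} (d : Fin K → ℕ) (S : Fin K → Matrix (Fin m) (Fin m) ℝ) (σ : Fin K → ℝ)

/-- Monotonicity upward: a letter of LARGER exponent that is `κ`-small against `b` at `v` is `κ`-small on `(0, v]`.
[folklore] -/
theorem small_of_small_at_right {σl σb κ x v : ℝ} {dl db : ℕ} (hσl : 0 ≤ σl) (hx : 0 < x) (hxv : x ≤ v)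
    (hd : db ≤ dl) (h : σl * v ^ dl ≤ κ * (σb * v ^ db)) : σl * x ^ dl ≤ κ * (σb * x ^ db) := by
  have hv : 0 < v := hx.trans_le hxv
  obtain ⟨e, rfl⟩ : ∃ e, dl = db + e := ⟨dl - db, by omega⟩
  rw [pow_add] at h ⊢
  have h1 : σl * x ^ e ≤ σl * v ^ e := mul_le_mul_of_nonneg_left (pow_le_pow_left₀ hx.le hxv e) hσl
  -- divide the hypothesis by `v^db > 0`
  have h2 : σl * v ^ e ≤ κ * σb := by
    have hvpos : 0 < v ^ db := pow_pos hv db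
    have : σl * v ^ e * v ^ db ≤ κ * σb * v ^ db := by nlinarith
    exact le_of_mul_le_mul_right this hvpos
  have hxpos : 0 < x ^ db := pow_pos hx db
  nlinarith

/-- Monotonicity downward: a letter of SMALLER exponent that is `κ`-small against `a` at `u` is `κ`-small on `[u, ∞)`.
[folklore] -/
theorem small_of_small_at_left {σl σa κ x u : ℝ} {dl da : ℕ} (hσl : 0 ≤ σl) (hu : 0 < u) (hux : u ≤ x)
    (hd : dl ≤ da) (h : σl * u ^ dl ≤ κ * (σa * u ^ da)) : σl * x ^ dl ≤ κ * (σa * x ^ da) := by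
  have hx : 0 < x := hu.trans_le hux
  obtain ⟨e, rfl⟩ : ∃ e, da = dl + e := ⟨da - dl, by omega⟩
  rw [pow_add] at h ⊢
  have hκσ : σl ≤ κ * σa * u ^ e := by
    have hupos : 0 < u ^ dl := pow_pos hu dl
    have : σl * u ^ dl ≤ κ * σa * u ^ e * u ^ dl := by nlinarith
    exact le_of_mul_le_mul_right this hupos
  have hκ0 : 0 ≤ κ * σa := by
    by_contra hneg
    rw [not_le] at hneg
    have : κ * σa * u ^ e < 0 := mul_neg_of_neg_of_pos hneg (pow_pos hu e)
    linarith
  have h1 : κ * σa * u ^ e ≤ κ * σa * x ^ e := mul_le_mul_of_nonneg_left (pow_le_pow_left₀ hu.le hux e) hκ0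
  have hxpos : 0 < x ^ dl := pow_pos hx dl
  nlinarith

/-- For any finite sequences `u, v` (`N ≥ 1`), every real `x` lies in the initial segment `(−∞, u 0]`, in the final
ray `[v (N−1), ∞)`, in some open window `(u j, v j)`, or in some closed gap `[v j, u (j+1)]` (take the largest `j`
with `u j < x`). [folklore] -/
theorem cover_of_chain {N : ℕ} (hN : 0 < N) (u v : Fin N → ℝ) (x : ℝ) :
    x ≤ u ⟨0, hN⟩ ∨ v ⟨N - 1, by omega⟩ ≤ x ∨ (∃ j, u j < x ∧ x < v j) ∨
      ∃ j j' : Fin N, j'.val = j.val + 1 ∧ v j ≤ x ∧ x ≤ u j' := by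
  classical
  by_cases h0 : x ≤ u ⟨0, hN⟩
  · exact Or.inl h0
  rw [not_le] at h0
  set J : Finset (Fin N) := Finset.univ.filter (fun j => u j < x) with hJ
  have hJne : J.Nonempty := ⟨⟨0, hN⟩, by rw [hJ, Finset.mem_filter]; exact ⟨Finset.mem_univ _, h0⟩⟩
  set j := J.max' hJne with hj
  have hjJ : j ∈ J := Finset.max'_mem J hJne
  rw [hJ, Finset.mem_filter] at hjJ
  by_cases hxv : x < v j
  · exact Or.inr (Or.inr (Or.inl ⟨j, hjJ.2, hxv⟩))
  rw [not_lt] at hxv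
  by_cases hlast : j.val = N - 1
  · right; left
    have : (⟨N - 1, by omega⟩ : Fin N) = j := Fin.ext (by simp [hlast])
    rw [this]; exact hxv
  · have hj1 : j.val + 1 < N := by have := j.isLt; omega
    set j' : Fin N := ⟨j.val + 1, hj1⟩ with hj'
    have hnot : ¬ (u j' < x) := by
      intro hlt
      have hmem : j' ∈ J := by rw [hJ, Finset.mem_filter]; exact ⟨Finset.mem_univ _, hlt⟩
      have hle := Finset.le_max' J j' hmem
      rw [← hj] at hle
      have : j'.val ≤ j.val := hle
      simp [hj'] at this
    rw [not_lt] at hnot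
    exact Or.inr (Or.inr (Or.inr ⟨j, j', rfl, hxv, hnot⟩))

/-- **ENDPOINT CERTIFICATE ⇒ LETTER-SEPARATED SECTOR.**  `N ≥ 1` windows `(u j, v j)` with live pairs
`(a j, b j)` chained along the exponent order (`a (j+1) = b j`, `v j ≤ u (j+1)`, `a 0` the lowest and `b (N−1)`
the highest letter, `d (a j) < d (b j)`); entry bounds `σ`, conditioning `|det S l| ≥ η σ_l^m`.  FINITELY MANY
MONOMIAL INEQUALITIES AT THE WINDOW ENDS: the pair hands over (`σ_b u^(d b) ≤ ε σ_a u^(d a)`,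
`σ_a v^(d a) ≤ ε σ_b v^(d b)`) and every other letter `l` is `κ j l`-small at the appropriate end of window `j`
(below `a`: at `u` against `a`; above `b`: at `v` against `b`) with weights `∑_l κ j l ≤ Λ` (so geometric
decay of far letters costs nothing extra).  If `ε' := 2ε + 2Λ ≤ 1` and `(m+1)^m·m!·m·3^m·ε' < η` then
`Z₊ ≤ N·m` — uniformly in `K`.  (Monotonicity of ratios of monomials turns the endpoint inequalities into the interval
hypotheses of `card_posRoots_le_of_relSeparated`; `cover_of_chain` gives the dominance cover of the gaps and the
two ends, where the two neighbouring letters are `ε`-small and the far ones sum to `≤ 2ε`.) [folklore] -/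
theorem card_posRoots_le_of_endpointCert (hσ : ∀ l i j, |S l i j| ≤ σ l) (hσpos : ∀ l, 0 < σ l)
    {η ε Λ : ℝ} (hdet : ∀ l, η * σ l ^ m ≤ |(S l).det|) (hε0 : 0 ≤ ε) (hΛ0 : 0 ≤ Λ)
    (hε1 : 2 * ε + 2 * Λ ≤ 1) (hεη : ((m : ℝ) + 1) ^ m * (m.factorial : ℝ) * m * 3 ^ m * (2 * ε + 2 * Λ) < η)
    {N : ℕ} (hN : 0 < N) (a b : Fin N → Fin K) (hab : ∀ j, d (a j) < d (b j)) (u v : Fin N → ℝ)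
    (hu : ∀ j, 0 < u j) (huv : ∀ j, u j < v j)
    (hchain : ∀ j j' : Fin N, j'.val = j.val + 1 → a j' = b j ∧ v j ≤ u j')
    (hlow : ∀ l, d (a ⟨0, hN⟩) ≤ d l) (hhigh : ∀ l, d l ≤ d (b ⟨N - 1, by omega⟩))
    (hhand : ∀ j, σ (b j) * u j ^ d (b j) ≤ ε * (σ (a j) * u j ^ d (a j)) ∧
      σ (a j) * v j ^ d (a j) ≤ ε * (σ (b j) * v j ^ d (b j)))
    (κ : Fin N → Fin K → ℝ) (hκ0 : ∀ j l, 0 ≤ κ j l) (hκsum : ∀ j, ∑ l, κ j l ≤ Λ)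
    (hother : ∀ j, ∀ l, l ≠ a j → l ≠ b j →
      (d l < d (a j) ∧ σ l * u j ^ d l ≤ κ j l * (σ (a j) * u j ^ d (a j))) ∨
      (d (b j) < d l ∧ σ l * v j ^ d l ≤ κ j l * (σ (b j) * v j ^ d (b j)))) :
    ((Matrix.det (∑ l, ((X : ℝ[X]) ^ d l) • (S l).map C)).roots.toFinset.filter (fun t => 0 < t)).card
      ≤ N * m := by
  classical
  have hσ0 : ∀ l, 0 ≤ σ l := fun l => (hσpos l).le
  set ε' : ℝ := 2 * ε + 2 * Λ with hε'
  have hεε' : ε ≤ ε' := by rw [hε']; linarith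
  have hΛε' : Λ ≤ ε' := by rw [hε']; linarith
  have hε'0 : 0 ≤ ε' := by rw [hε']; positivity
  have hεle1 : ε ≤ 1 := by linarith
  -- generic weighted sum bound
  have sum_le : ∀ (s : Finset (Fin K)) (f : Fin K → ℝ) (w : Fin K → ℝ) (T : ℝ), 0 ≤ T → (∀ l, 0 ≤ w l) →
      (∀ l ∈ s, f l ≤ w l * T) → ∑ l ∈ s, f l ≤ (∑ l, w l) * T := by
    intro s f w T hT hw hf
    calc ∑ l ∈ s, f l ≤ ∑ l ∈ s, w l * T := Finset.sum_le_sum hf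
      _ ≤ ∑ l, w l * T := Finset.sum_le_sum_of_subset_of_nonneg (Finset.subset_univ s)
          (fun l _ _ => mul_nonneg (hw l) hT)
      _ = (∑ l, w l) * T := by rw [Finset.sum_mul]
  -- `κ`-small against a letter that is `ε`-small against the live one ⇒ `κ`-small against the live one
  have shrink : ∀ {t κ' T' T : ℝ}, 0 ≤ κ' → 0 ≤ T → t ≤ κ' * T' → T' ≤ ε * T → t ≤ κ' * T := by
    intro t κ' T' T hκ' hT ht hT'
    have : T' ≤ T := hT'.trans (by nlinarith)
    nlinarith
  -- (1) interior of window `j`: other letters `≤ ε · max`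
  have hwin : ∀ j, ∀ x ∈ Set.Icc (u j) (v j), ∑ l ∈ (Finset.univ.erase (a j)).erase (b j), σ l * x ^ d l ≤
      ε' * max (σ (a j) * x ^ d (a j)) (σ (b j) * x ^ d (b j)) := by
    intro j x hx
    have hx0 : 0 < x := (hu j).trans_le hx.1
    have hT : 0 ≤ max (σ (a j) * x ^ d (a j)) (σ (b j) * x ^ d (b j)) :=
      le_max_of_le_left (mul_nonneg (hσ0 _) (pow_nonneg hx0.le _))
    refine (sum_le _ _ (κ j) _ hT (hκ0 j) fun l hl => ?_).trans
      (mul_le_mul_of_nonneg_right ((hκsum j).trans hΛε') hT)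
    rw [Finset.mem_erase, Finset.mem_erase] at hl
    rcases hother j l hl.2.1 hl.1 with ⟨hdl, hs⟩ | ⟨hdl, hs⟩
    · exact (small_of_small_at_left (hσ0 l) (hu j) hx.1 hdl.le hs).trans
        (mul_le_mul_of_nonneg_left (le_max_left _ _) (hκ0 j l))
    · exact (small_of_small_at_right (hσ0 l) hx0 hx.2 hdl.le hs).trans
        (mul_le_mul_of_nonneg_left (le_max_right _ _) (hκ0 j l))
  -- (2) the cover with `ε'`-dominance outside the windows
  have hcover : ∀ x : ℝ, 0 < x → (∃ j, u j < x ∧ x < v j) ∨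
      ∃ l₀ : Fin K, ∑ l ∈ Finset.univ.erase l₀, σ l * x ^ d l ≤ ε' * (σ l₀ * x ^ d l₀) := by
    intro x hx
    -- a pointwise bound summing to `≤ (2ε + 2Λ) T`
    have dom : ∀ (L : Fin K) (n₁ n₂ : Fin K) (w : Fin K → ℝ), (∀ l, 0 ≤ w l) → ∑ l, w l ≤ 2 * Λ →
        (∀ l, l ≠ L → l ≠ n₁ → l ≠ n₂ → σ l * x ^ d l ≤ w l * (σ L * x ^ d L)) →
        σ n₁ * x ^ d n₁ ≤ ε * (σ L * x ^ d L) ∨ n₁ = L →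
        σ n₂ * x ^ d n₂ ≤ ε * (σ L * x ^ d L) ∨ n₂ = L →
        ∑ l ∈ Finset.univ.erase L, σ l * x ^ d l ≤ ε' * (σ L * x ^ d L) := by
      intro L n₁ n₂ w hw hwsum hκs hn₁ hn₂
      have hT : 0 ≤ σ L * x ^ d L := mul_nonneg (hσ0 L) (pow_nonneg hx.le _)
      have hεT : 0 ≤ ε * (σ L * x ^ d L) := mul_nonneg hε0 hT
      have hpt : ∀ l ∈ Finset.univ.erase L, σ l * x ^ d l ≤
          w l * (σ L * x ^ d L) + (if l = n₁ then ε * (σ L * x ^ d L) else 0) +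
            (if l = n₂ then ε * (σ L * x ^ d L) else 0) := by
        intro l hl
        rw [Finset.mem_erase] at hl
        have hwT : 0 ≤ w l * (σ L * x ^ d L) := mul_nonneg (hw l) hT
        by_cases h1 : l = n₁
        · subst h1
          rcases hn₁ with h | h
          · rw [if_pos rfl]; split_ifs <;> linarith
          · exact absurd h hl.1
        by_cases h2 : l = n₂
        · subst h2
          rcases hn₂ with h | h
          · rw [if_neg h1, if_pos rfl]; linarith
          · exact absurd h hl.1
        rw [if_neg h1, if_neg h2, add_zero, add_zero]
        exact hκs l hl.1 h1 h2
      refine (Finset.sum_le_sum hpt).trans ?_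
      rw [Finset.sum_add_distrib, Finset.sum_add_distrib, Finset.sum_ite_eq', Finset.sum_ite_eq']
      have hw' : ∑ l ∈ Finset.univ.erase L, w l * (σ L * x ^ d L) ≤ 2 * Λ * (σ L * x ^ d L) := by
        rw [← Finset.sum_mul]
        refine mul_le_mul_of_nonneg_right ?_ hT
        exact (Finset.sum_le_sum_of_subset_of_nonneg (Finset.subset_univ _) (fun l _ _ => hw l)).trans hwsum
      have hi1 : (if n₁ ∈ Finset.univ.erase L then ε * (σ L * x ^ d L) else 0) ≤ ε * (σ L * x ^ d L) := by
        split_ifs <;> linarith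
      have hi2 : (if n₂ ∈ Finset.univ.erase L then ε * (σ L * x ^ d L) else 0) ≤ ε * (σ L * x ^ d L) := by
        split_ifs <;> linarith
      rw [hε']
      linarith
    rcases cover_of_chain hN u v x with hbot | htop | hwinx | hgap
    · -- bottom: live letter `a 0`
      right
      set j₀ : Fin N := ⟨0, hN⟩
      have hT : 0 ≤ σ (a j₀) * x ^ d (a j₀) := mul_nonneg (hσ0 _) (pow_nonneg hx.le _)
      have hb0 : σ (b j₀) * x ^ d (b j₀) ≤ ε * (σ (a j₀) * x ^ d (a j₀)) :=
        small_of_small_at_right (hσ0 _) hx hbot (hab j₀).le (hhand j₀).1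
      refine ⟨a j₀, dom (a j₀) (b j₀) (b j₀) (κ j₀) (hκ0 j₀) ((hκsum j₀).trans (by linarith))
        (fun l hl hb _ => ?_) (Or.inl hb0) (Or.inl hb0)⟩
      rcases hother j₀ l hl hb with ⟨hdl, -⟩ | ⟨hdl, hs⟩
      · exact absurd (hlow l) (not_le.2 hdl)
      · exact shrink (hκ0 j₀ l) hT (small_of_small_at_right (hσ0 l) hx (hbot.trans (huv j₀).le) hdl.le hs) hb0
    · -- top: live letter `b (N-1)`
      right
      set j₁ : Fin N := ⟨N - 1, by omega⟩
      have hv0 : 0 < v j₁ := (hu j₁).trans (huv j₁)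
      have hT : 0 ≤ σ (b j₁) * x ^ d (b j₁) := mul_nonneg (hσ0 _) (pow_nonneg hx.le _)
      have ha1 : σ (a j₁) * x ^ d (a j₁) ≤ ε * (σ (b j₁) * x ^ d (b j₁)) :=
        small_of_small_at_left (hσ0 _) hv0 htop (hab j₁).le (hhand j₁).2
      refine ⟨b j₁, dom (b j₁) (a j₁) (a j₁) (κ j₁) (hκ0 j₁) ((hκsum j₁).trans (by linarith))
        (fun l hl ha _ => ?_) (Or.inl ha1) (Or.inl ha1)⟩
      rcases hother j₁ l ha hl with ⟨hdl, hs⟩ | ⟨hdl, -⟩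
      · exact shrink (hκ0 j₁ l) hT (small_of_small_at_left (hσ0 l) (hu j₁) ((huv j₁).le.trans htop) hdl.le hs) ha1
      · exact absurd (hhigh l) (not_le.2 hdl)
    · exact Or.inl hwinx
    · -- gap between window `j` and `j'`: live letter `b j = a j'`
      right
      obtain ⟨j, j', hjj', hvx, hxu⟩ := hgap
      obtain ⟨haj', hvu⟩ := hchain j j' hjj'
      have hv0 : 0 < v j := (hu j).trans (huv j)
      have hT : 0 ≤ σ (b j) * x ^ d (b j) := mul_nonneg (hσ0 _) (pow_nonneg hx.le _)
      have haj : σ (a j) * x ^ d (a j) ≤ ε * (σ (b j) * x ^ d (b j)) :=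
        small_of_small_at_left (hσ0 _) hv0 hvx (hab j).le (hhand j).2
      have hbj' : σ (b j') * x ^ d (b j') ≤ ε * (σ (b j) * x ^ d (b j)) := by
        have h2 := small_of_small_at_right (hσ0 (b j')) hx hxu (hab j').le (hhand j').1
        rwa [haj'] at h2
      refine ⟨b j, dom (b j) (a j) (b j') (fun l => κ j l + κ j' l) (fun l => add_nonneg (hκ0 j l) (hκ0 j' l))
        (by rw [Finset.sum_add_distrib]; linarith [hκsum j, hκsum j']) (fun l hl ha hb' => ?_)
        (Or.inl haj) (Or.inl hbj')⟩
      rcases lt_or_ge (d l) (d (b j)) with hdl | hdl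
      · -- below the live letter: window `j` certifies it at `u j`
        rcases hother j l ha hl with ⟨hdl', hs⟩ | ⟨hdl', -⟩
        · have h1 := shrink (hκ0 j l) hT
            (small_of_small_at_left (hσ0 l) (hu j) ((huv j).le.trans hvx) hdl'.le hs) haj
          exact h1.trans (mul_le_mul_of_nonneg_right (le_add_of_nonneg_right (hκ0 j' l)) hT)
        · exact absurd hdl (not_lt.2 hdl'.le)
      · -- above the live letter: window `j'` certifies it at `v j'`
        have hl' : l ≠ a j' := by rw [haj']; exact hl
        rcases hother j' l hl' hb' with ⟨hdl', -⟩ | ⟨hdl', hs⟩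
        · rw [haj'] at hdl'; exact absurd hdl (not_le.2 hdl')
        · have h1 := shrink (hκ0 j' l) hT
            (small_of_small_at_right (hσ0 l) hx (hxu.trans (huv j').le) hdl'.le hs) hbj'
          exact h1.trans (mul_le_mul_of_nonneg_right (le_add_of_nonneg_left (hκ0 j l)) hT)
  exact card_posRoots_le_of_relSeparated d S σ hσ hσpos hdet hε'0 hε1 hεη a b hab u v hu huv
    (fun j => (hhand j).1.trans (mul_le_mul_of_nonneg_right hεε' (mul_nonneg (hσ0 _) (pow_nonneg (hu j).le _))))
    (fun j => (hhand j).2.trans (mul_le_mul_of_nonneg_right hεε'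
      (mul_nonneg (hσ0 _) (pow_nonneg ((hu j).trans (huv j)).le _))))
    hwin hcover

end Endpoint

end Summit.ValiantsHypothesis.ValiantsHypothesis.Theorems.LacunarySymmetroidMatrixDescartes.Separated
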